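import Literature.Computability.AlgebraicComplexity.SmallFormatRankFlag
import HarnessLib

/-!
# ω-census family (a): in an `r`-term algorithm for `⟨2,2,n⟩` with `r < 4n`, at most `r − 2n − 1` of the
X-forms vanish on a rank-one plane `{λ zᵀ}` (one better than substitution)

Cell `pub-omega` (unit `pub-omega-lit`, gen 5), topic `Summits/MatrixMultiplication/OmegaCensus`
(sub-folder `SmallFormats`). Framing (verbatim): lottery ticket; floor = certified bounds/negative
ranges. HONEST FRAMING: an elementary structural lemma (ours), motivated by Alekseev 2015
(Chebyshevskiĭ Sb. 16:4, Lemmas 6–7 and §4: a 17-term algorithm for `⟨5,2,2⟩` cannot have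
'parameters `(10, 7)`'), proved here directly and for every `r < 4n`; it is a CAP for the
structured searches of the census (the `𝔽₃` rung `⟨2,2,5⟩ @ 17`), not a bound on any rank and not
progress on `ω`.

**Theorem** (`card_vanishing_add_lt`). Let `k` be a field, `β` a bilinear computation (Bläser 2003,
Def. 1; tree `BilinComp`) of `⟨2,2,n⟩ : (X, Y) ↦ XY` of length `r = |ι| < 4n`, `λ ∈ k² ∖ 0`, and `R` a
set of indices whose X-forms vanish on the plane `S_λ = {λ zᵀ : z ∈ k²}` (all `2 × 2` matrices whose
columns are multiples of `λ`). Then `|R| + 2n + 1 ≤ r`. Plain substitution (restrict `X` to `S_λ`; the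
survivors compute `(z, Y) ↦ λ zᵀ Y ≅ ⟨1,2,n⟩` of rank `2n`) gives only `|R| + 2n ≤ r`.

*Proof.* Suppose `|R| ≥ r − 2n`. Restricting to `X = λ zᵀ` kills `R`; the `≤ 2n` survivors `Rᶜ`
compute `λ ⊗ (zᵀY)`, so (Y-flattening) `|Rᶜ| = 2n` and the bilinear forms `f_i(λzᵀ) g_i(Y)`,
`i ∈ Rᶜ`, are linearly independent (a dependency would shorten the computation to `2n − 1` terms).
With `θ ⊥ λ`, the `θ`-row of `λ zᵀ Y` vanishes, hence so does `∑_{i∈Rᶜ} f_i(λzᵀ) g_i(Y) (θᵀ w_i)`, and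
independence gives `θᵀ w_i = 0` for `i ∈ Rᶜ`. Taking the `θ`-row of the full identity `XY = ∑ …`
leaves only the `R`-terms computing `(X, Y) ↦ θᵀXY`, whose Y-flattening has rank `2n`; so
`|R| ≥ 2n` and `r = |R| + |Rᶜ| ≥ 4n`, a contradiction.

Use (census): over `𝔽₃`, `n = 5`, `r = 17`: each of the 4 planes `S_λ` carries at most 6 vanishing
X-forms (substitution: 7); at `r = 18` at most 7 (substitution: 8).
-/

namespace Summit.MatrixMultiplication.OmegaCensus.RankOnePlaneCap

open Module Matrix Literature.Computability.AlgebraicComplexity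

variable {k : Type*} [Field k] {n : ℕ} {ι : Type*} [Fintype ι]

/-- `θ ᵥ* (a • W) = a • (θ ᵥ* W)` (row combinations commute with scalars). -/
theorem vecMul_smul_matrix (θ : Fin 2 → k) (a : k) (W : Matrix (Fin 2) (Fin n) k) :
    θ ᵥ* (a • W) = a • (θ ᵥ* W) := by
  ext ν
  simp [Matrix.vecMul, dotProduct, Fin.sum_univ_two]
  ring

omit [Fintype ι] in
/-- `θ ᵥ* (∑ a_i • W_i) = ∑ a_i • (θ ᵥ* W_i)`. -/
theorem vecMul_sum_smul (θ : Fin 2 → k) (s : Finset ι) (a : ι → k)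
    (W : ι → Matrix (Fin 2) (Fin n) k) :
    θ ᵥ* (∑ i ∈ s, a i • W i) = ∑ i ∈ s, a i • (θ ᵥ* W i) := by
  classical
  induction s using Finset.induction_on with
  | empty => simp
  | insert j s hj ih =>
      rw [Finset.sum_insert hj, Finset.sum_insert hj, Matrix.vecMul_add, vecMul_smul_matrix, ih]

/-- `dim k^{2×n} = 2n`. -/
theorem finrank_top_matrix : finrank k (⊤ : Submodule k (Matrix (Fin 2) (Fin n) k)) = 2 * n := by
  rw [finrank_top]
  simp [Module.finrank_matrix]

/-- Y-flattening count for the restricted map: if `(λ zᵀ) Y = ∑_{i∈J} a_i(z) g_i(Y) • w'_i` for all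
`z, Y` with `λ ≠ 0`, then the `g_i`, `i ∈ J`, have no common zero `Y ≠ 0`, hence `2n ≤ |J|`. -/
theorem two_mul_le_card_of_restr (g : ι → Module.Dual k (Matrix (Fin 2) (Fin n) k))
    {lam : Fin 2 → k} (hlam : lam ≠ 0) (J : Finset ι) (a : ι → (Fin 2 → k) → k)
    (w' : ι → Matrix (Fin 2) (Fin n) k)
    (h : ∀ (z : Fin 2 → k) (Y : Matrix (Fin 2) (Fin n) k),
      vecMulVec lam z * Y = ∑ i ∈ J, (a i z * g i Y) • w' i) :
    2 * n ≤ J.card := by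
  classical
  obtain ⟨κ', hκ'⟩ : ∃ κ, lam κ ≠ 0 := by
    by_contra h0
    simp only [not_exists, not_not] at h0
    exact hlam (funext h0)
  have key : ∀ Y ∈ (⊤ : Submodule k (Matrix (Fin 2) (Fin n) k)), (∀ i ∈ J, g i Y = 0) → Y = 0 := by
    intro Y _ hY
    ext μ ν
    have h1 := h (Pi.single μ 1) Y
    rw [Finset.sum_eq_zero (fun i hi => by rw [hY i hi, mul_zero, zero_smul])] at h1
    have h2 := congrFun (congrFun h1 κ') ν
    simp [Matrix.mul_apply, vecMulVec_apply, Pi.single_apply, hκ'] at h2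
    simpa using h2
  have := BilinComp.finrank_le_card_of_forall_eq_zero ⊤ J g key
  rwa [finrank_top_matrix] at this

/-- **Rank-one plane cap.** In a bilinear computation of `⟨2,2,n⟩` of length `< 4n`, a set `R` of
indices whose X-forms vanish on `{λ zᵀ : z}` (`λ ≠ 0`) has `|R| + 2n + 1 ≤ |ι|`. -/
theorem card_vanishing_add_lt (hn4 : Fintype.card ι < 4 * n) (β : BilinComp (mulBilin k 2 2 n) ι)
    {lam : Fin 2 → k} (hlam : lam ≠ 0) (R : Finset ι)
    (hR : ∀ i ∈ R, ∀ z : Fin 2 → k, β.f i (vecMulVec lam z) = 0) :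
    R.card + 2 * n + 1 ≤ Fintype.card ι := by
  classical
  by_contra hlt
  rw [not_le] at hlt
  set Rc : Finset ι := Finset.univ \ R with hRc
  have hcardR : Rc.card + R.card = Fintype.card ι := by
    rw [hRc, Finset.card_sdiff_add_card_eq_card (Finset.subset_univ R), Finset.card_univ]
  -- (A1) restriction to `X = λ zᵀ` kills the terms of `R`
  have A1 : ∀ (z : Fin 2 → k) (Y : Matrix (Fin 2) (Fin n) k), vecMulVec lam z * Y =
      ∑ i ∈ Rc, (β.f i (vecMulVec lam z) * β.g i Y) • β.w i := by
    intro z Y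
    have h := β.map_eq_sum (vecMulVec lam z) Y
    rw [mulBilin_apply] at h
    rw [h, ← Finset.sum_sdiff (Finset.subset_univ R), add_eq_left]
    exact Finset.sum_eq_zero fun i hi => by rw [hR i hi, zero_mul, zero_smul]
  -- (A2) the survivors are exactly `2n`
  have A2 : 2 * n ≤ Rc.card :=
    two_mul_le_card_of_restr β.g hlam Rc (fun i z => β.f i (vecMulVec lam z)) β.w A1
  have hRc2 : Rc.card = 2 * n := by omega
  -- (A3) the surviving bilinear forms are linearly independent
  have A3 : ∀ c : ι → k, (∀ (z : Fin 2 → k) (Y : Matrix (Fin 2) (Fin n) k),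
      ∑ i ∈ Rc, c i * (β.f i (vecMulVec lam z) * β.g i Y) = 0) → ∀ i ∈ Rc, c i = 0 := by
    intro c hc
    by_contra hne
    simp only [not_forall, exists_prop] at hne
    obtain ⟨i0, hi0, hc0⟩ := hne
    set J : Finset ι := Rc.erase i0 with hJ
    have hJc : J.card = 2 * n - 1 := by rw [hJ, Finset.card_erase_of_mem hi0, hRc2]
    have hid : ∀ (z : Fin 2 → k) (Y : Matrix (Fin 2) (Fin n) k), vecMulVec lam z * Y =
        ∑ i ∈ J, (β.f i (vecMulVec lam z) * β.g i Y) • (β.w i - (c i / c i0) • β.w i0) := by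
      intro z Y
      set t : ι → k := fun i => β.f i (vecMulVec lam z) * β.g i Y with ht
      have e1 : vecMulVec lam z * Y = t i0 • β.w i0 + ∑ i ∈ J, t i • β.w i := by
        rw [A1 z Y, hJ, Finset.add_sum_erase Rc (fun i => t i • β.w i) hi0]
      have e2 : c i0 * t i0 + ∑ i ∈ J, c i * t i = 0 := by
        rw [hJ, Finset.add_sum_erase Rc (fun i => c i * t i) hi0]
        exact hc z Y
      have e4 : t i0 = -(∑ i ∈ J, (c i / c i0) * t i) := by
        have h6 : t i0 = (c i0)⁻¹ * (c i0 * t i0) := by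
          rw [← mul_assoc, inv_mul_cancel₀ hc0, one_mul]
        rw [h6, eq_neg_of_add_eq_zero_left e2, mul_neg, Finset.mul_sum]
        congr 1
        refine Finset.sum_congr rfl fun i _ => ?_
        rw [div_eq_mul_inv]
        ring
      calc vecMulVec lam z * Y = t i0 • β.w i0 + ∑ i ∈ J, t i • β.w i := e1
        _ = ∑ i ∈ J, (t i • β.w i - ((c i / c i0) * t i) • β.w i0) := by
            rw [e4, Finset.sum_sub_distrib, ← Finset.sum_smul, neg_smul]
            abel
        _ = ∑ i ∈ J, t i • (β.w i - (c i / c i0) • β.w i0) :=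
            Finset.sum_congr rfl fun i _ => by rw [smul_sub, smul_smul, mul_comm]
    have h2n := two_mul_le_card_of_restr β.g hlam J (fun i z => β.f i (vecMulVec lam z))
      (fun i => β.w i - (c i / c i0) • β.w i0) hid
    omega
  -- an output functional `θ ⊥ λ`
  set θ : Fin 2 → k := ![lam 1, -lam 0] with hθ
  have hθlam : ∀ z : Fin 2 → k, θ ᵥ* vecMulVec lam z = 0 := by
    intro z
    ext μ
    simp [Matrix.vecMul, dotProduct, vecMulVec_apply, Fin.sum_univ_two, hθ]
    ring
  obtain ⟨κ', hκ'⟩ : ∃ κ, θ κ ≠ 0 := by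
    by_contra h0
    simp only [not_exists, not_not] at h0
    apply hlam
    ext i
    fin_cases i
    · simpa [hθ] using h0 1
    · simpa [hθ] using h0 0
  -- (A4) the outputs of the survivors have zero `θ`-row
  have A4 : ∀ i ∈ Rc, θ ᵥ* β.w i = 0 := by
    intro i hi
    ext ν
    have hc := A3 (fun j => (θ ᵥ* β.w j) ν) ?_ i hi
    · simpa using hc
    · intro z Y
      have h1 : θ ᵥ* (vecMulVec lam z * Y) =
          θ ᵥ* ∑ i ∈ Rc, (β.f i (vecMulVec lam z) * β.g i Y) • β.w i := by rw [A1 z Y]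
      rw [← Matrix.vecMul_vecMul, hθlam z, Matrix.zero_vecMul, vecMul_sum_smul] at h1
      have h2 := congrFun h1 ν
      rw [Pi.zero_apply, Finset.sum_apply] at h2
      refine Eq.trans (Finset.sum_congr rfl fun j _ => ?_) h2.symm
      simp [mul_comm]
  -- (A5) the `R`-terms alone compute `(X, Y) ↦ θᵀ X Y`, whose Y-flattening has rank `2n`
  have A5 : 2 * n ≤ R.card := by
    have key : ∀ Y ∈ (⊤ : Submodule k (Matrix (Fin 2) (Fin n) k)),
        (∀ i ∈ R, β.g i Y = 0) → Y = 0 := by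
      intro Y _ hY
      ext μ ν
      have h := β.map_eq_sum (Matrix.single κ' μ (1 : k)) Y
      rw [mulBilin_apply] at h
      have hR0 : θ ᵥ* (∑ i, (β.f i (Matrix.single κ' μ (1 : k)) * β.g i Y) • β.w i) = 0 := by
        rw [vecMul_sum_smul]
        refine Finset.sum_eq_zero fun i _ => ?_
        by_cases hiR : i ∈ R
        · rw [hY i hiR, mul_zero, zero_smul]
        · rw [A4 i (Finset.mem_sdiff.2 ⟨Finset.mem_univ i, hiR⟩), smul_zero]
      have h1 : θ ᵥ* (Matrix.single κ' μ (1 : k) * Y) = 0 := by rw [h]; exact hR0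
      have h2 := congrFun h1 ν
      simp [Matrix.vecMul, dotProduct, single_mul_apply', hκ'] at h2
      exact h2
    have := BilinComp.finrank_le_card_of_forall_eq_zero ⊤ R β.g key
    rwa [finrank_top_matrix] at this
  omega

/-- Cap form: with `r = |ι| < 4n`, at most `r − 2n − 1` X-forms vanish on the plane `{λ zᵀ}`. -/
theorem card_vanishing_le (hn4 : Fintype.card ι < 4 * n) (β : BilinComp (mulBilin k 2 2 n) ι)
    {lam : Fin 2 → k} (hlam : lam ≠ 0) (R : Finset ι)
    (hR : ∀ i ∈ R, ∀ z : Fin 2 → k, β.f i (vecMulVec lam z) = 0) :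
    R.card ≤ Fintype.card ι - 2 * n - 1 := by
  have := card_vanishing_add_lt hn4 β hlam R hR
  omega

/-- Coordinate form (`λ = e_κ₀`): the X-forms that vanish on every matrix supported on row `κ₀`
(`vecMulVec (Pi.single κ₀ 1) z` is the matrix with row `κ₀` equal to `z` and the other row `0`), i.e.
the X-forms that do NOT read row `κ₀` of `X` — for `2 × 2` matrices: that read only the other row. At
most `r − 2n − 1` of them when `r < 4n`. -/
theorem card_notReadingRow_add_lt (hn4 : Fintype.card ι < 4 * n)
    (β : BilinComp (mulBilin k 2 2 n) ι) (κ₀ : Fin 2) (R : Finset ι)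
    (hR : ∀ i ∈ R, ∀ z : Fin 2 → k, β.f i (vecMulVec (Pi.single κ₀ 1) z) = 0) :
    R.card + 2 * n + 1 ≤ Fintype.card ι :=
  card_vanishing_add_lt hn4 β (lam := Pi.single κ₀ 1)
    (by
      intro h
      have := congrFun h κ₀
      simp at this) R hR

/-- Same statement as `card_notReadingRow_add_lt` under its first (misleading) name: the hypothesis
says the forms VANISH on the matrices supported on row `κ₀` (they do not read row `κ₀`). Kept for
append-only compatibility. -/
@[deprecated card_notReadingRow_add_lt (since := "2026-08-21")]
theorem card_readsOnlyRow_add_lt (hn4 : Fintype.card ι < 4 * n)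
    (β : BilinComp (mulBilin k 2 2 n) ι) (κ₀ : Fin 2) (R : Finset ι)
    (hR : ∀ i ∈ R, ∀ z : Fin 2 → k, β.f i (vecMulVec (Pi.single κ₀ 1) z) = 0) :
    R.card + 2 * n + 1 ≤ Fintype.card ι :=
  card_notReadingRow_add_lt hn4 β κ₀ R hR

/-- **Census instance `⟨2,2,5⟩ @ 17`** (the open `𝔽₃` rung, but valid over every field): in a
17-term bilinear algorithm for `⟨2,2,5⟩`, at most `6` X-forms vanish on a plane `{λ zᵀ}`
(substitution alone: `7`). -/
theorem card_vanishing_le_six_225 {ι : Type*} [Fintype ι] (h17 : Fintype.card ι = 17)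
    (β : BilinComp (mulBilin k 2 2 5) ι) {lam : Fin 2 → k} (hlam : lam ≠ 0) (R : Finset ι)
    (hR : ∀ i ∈ R, ∀ z : Fin 2 → k, β.f i (vecMulVec lam z) = 0) : R.card ≤ 6 := by
  have := card_vanishing_add_lt (by omega) β hlam R hR
  omega

/-- **Census instance `⟨2,2,5⟩ @ 18`**: in an 18-term bilinear algorithm for `⟨2,2,5⟩` (such
algorithms exist: Hopcroft–Kerr 1971), at most `7` X-forms vanish on a plane `{λ zᵀ}`
(substitution alone: `8`). -/
theorem card_vanishing_le_seven_225 {ι : Type*} [Fintype ι] (h18 : Fintype.card ι = 18)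
    (β : BilinComp (mulBilin k 2 2 5) ι) {lam : Fin 2 → k} (hlam : lam ≠ 0) (R : Finset ι)
    (hR : ∀ i ∈ R, ∀ z : Fin 2 → k, β.f i (vecMulVec lam z) = 0) : R.card ≤ 7 := by
  have := card_vanishing_add_lt (by omega) β hlam R hR
  omega

end Summit.MatrixMultiplication.OmegaCensus.RankOnePlaneCap
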